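import Literature.NumberTheory.LFunctions.Zhang2022.Section3Lemma32Flat
import Literature.NumberTheory.LFunctions.Zhang2022.RepairGapLemma31ScaleLaw
import HarnessLib

/-!
# Zhang (2022), rescue GAP/REQSIDE (D-0124 (4)–(5)): the SCALE LAW of Lemma 3.2♭ — the four-factor
# moment `∑_{D⁴<n≤D⁸} ν(n)²d(n)/n` is `≪ 𝓛^{−k}` as soon as `‖L(1,χ)‖ ≤ 𝓛^{−(k+7)}`
# (printed-shape: `2022 ↦ 2015`)

Topic `Literature/NumberTheory/LFunctions/Zhang2022` (Landau–Siegel audit tree; verdict-neutral).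
Y. Zhang, *Discrete mean estimates and the Landau–Siegel zero*, arXiv:2211.02515v1 (2022)
[Zhang2022LandauSiegel] — **an unrefereed manuscript under adjudication; nothing in this file asserts or
denies its Theorems 1–2, and nothing here is a claim about Landau–Siegel zeros. The programme SEARCHES and
TYPES; no claim about Landau–Siegel zeros, Theorems 1–2 of arXiv:2211.02515 or a repaired Margin232 until a
kernel theorem says so.**

Lemma 3.2 (§3 p. 7: "Assume (A) holds. Then `∑_{D⁴<n≤D⁸} ν(n)²τ₂(n)²/n ≪ 𝓛^{−2007}`", eight `L`-factors,
subconvexity needed for the shifted line) is carried in the tree by its input-free FOUR-FACTOR variant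
"Lemma 3.2♭" `Lemma32Flat.lemma_3_2_flat` (`∑_{D⁴<n≤D⁸} ν(n)²d(n)/n ≤ C𝓛^{−2015}` under (A), file
`Section3Lemma32Flat`), which with the elementary reduction `∑ς²/n ≤ 4(1+log D⁴)⁸·∑ν²d/n`
(`Section3SigmaSplitting`) gives the printed input `𝓛^{−2007}` of Lemma 3.6 (`Lemma36Input.lemma_3_6_input`)
— no subconvexity. The rescue's exponent budget (kit LP-3 j271838; kernel twin `Repair.Gap.ExpTuple`,
`RepairGapExponentBudget`) carries the Lemma 3.2 step as the DESK READING «saving `s₂ = E − 15`»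
(`ExpTuple.s2`: printed `2007 = 2022 − 15`), feeding `e₄ = (s₂ − 2) − 2τ₄`, the second S0 binding chain.
This file DERIVES the four-factor half of that reading from the tree's proof with the exponent free:

* `norm_hnum_le_sphere_scale`, `norm_iteratedDeriv_hnum_le_scale` — on the circle `|z| = 𝓛^{−(k+9)}`, under
  `‖L(1,χ)‖ ≤ 𝓛^{−(k+7)}`: `‖h(z)‖ ≤ K_res·2(log A + log B)·𝓛^{−4(k+7)}` and Cauchy's estimate for `h‴(0)`
  (the tree's `Lemma32Flat.norm_hnum_le_sphere` / `norm_iteratedDeriv_hnum_le` with `2022 ↦ k+7`,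
  `2024 ↦ k+9`);
* `aux_logpow5_scale` — `(1+𝓛)⁵/D^{1/4} ≤ 32·(4(m+5))^{m+5}𝓛^{−m}` for every `m`;
* `lemma32Flat_scale_of_norm_le` — SUFFICIENCY: for every natural `k` there is `C = C(k)` with
  `∑_{D⁴<n≤N} |ν(n)|²d(n)/n ≤ C𝓛^{−k}` for all `N ≤ D⁸`, `log D ≥ 3`, `χ` primitive quadratic with
  `‖L(1,χ)‖ ≤ 𝓛^{−(k+7)}`: the residue of the ORDER-FOUR pole costs `6·K_res·24𝓛·𝓛^{−4(k+7)}·𝓛^{3(k+9)} =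
  144K_res𝓛^{−k}` (the manuscript's count `k·a* − (k−1)a*`-style: `4(k+7) − 3(k+9) − 1 = k`), the shifted line
  `O_k(𝓛^{−k})`; the printed-shape lemma is `k = 2015`;
* `lemma32Flat_scale_of_assumptionAWith` — from `Repair.Bed.AssumptionAWith E`, every real `E ≥ k + 7`.

READING (GAP G-31 / REQSIDE (5), as-typed): the four-factor moment consumes (A) at exponent `k + 7` for a
saving `𝓛^{−k}` over `D⁴ < n ≤ D⁸`; with the `(1 + log D⁴)⁸ ≤ 5⁸𝓛⁸` of the elementary reduction the Lemma 3.6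
input costs `k + 15` — the desk's `s₂ = E − 15` as a theorem about `L`-functions along the tree's
subconvexity-free route (file `RepairGapLemma36ScaleLaw`). Sufficiency only; theorems only; no definition,
no named fact; nothing about (A) itself is asserted.

## References

* Y. Zhang, arXiv:2211.02515v1 (2022), §3 Lemmas 3.1–3.2 and their proofs (p. 7, pp. 12–13); Assumption (A)
  p. 4. [cite: Zhang2022LandauSiegel, §3, Lemma 3.2]
-/

noncomputable section

open Complex Filter Topology Set MeasureTheory Real Metric
open scoped LSeries.notation

namespace Literature.NumberTheory.LFunctions.Zhang2022.Repair.Gap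

open Literature.NumberTheory.LFunctions.DivisorSumCharSq (eps W)
open Literature.NumberTheory.LFunctions.Zhang2022.Lemma31 (norm_LFunction_one_add_sub_le
  ne_one_of_isPrimitive eight_lt_exp_three)
open Literature.NumberTheory.LFunctions.Zhang2022.PhiFlat (phiFlat norm_phiFlat_le_of_re_cpow_nonneg
  re_natCast_cpow_neg_nonneg)
open Literature.NumberTheory.LFunctions.ZetaM4 (CΓ CΓ_pos norm_Gamma_strip_le)
open Literature.NumberTheory.LFunctions.Zhang2022.Lemma32Flat (coeff gF hnum Fint Psum Psum_nonneg Kres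
  Kres_nonneg KlineFlat KlineFlat_pos norm_eps_le_small differentiableOn_hnum differentiableOn_Fint
  Fint_eq_hnum_div integrable_Fint_line Fint_horizontal_decay integral_Fint_line_two
  norm_integral_Fint_line_le)
open Literature.NumberTheory.LFunctions.Zhang2022.Repair.Bed (AssumptionAWith)

variable {D : ℕ} [NeZero D] (χ : DirichletCharacter ℂ D) {A B : ℝ}

/-! ## The residue of the order-four pole with the exponent free -/

/-- **`h` on the circle `|z| = 𝓛^{−(k+9)}`** (`χ` primitive mod `D`, `χ² = 1`, `𝓛 = log D ≥ 3`,
`‖L(1,χ)‖ ≤ 𝓛^{−(k+7)}`, `1 ≤ A, B`, `log A, log B ≤ 8𝓛`): `‖h(z)‖ ≤ K_res · 2(log A + log B) · 𝓛^{−4(k+7)}`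
(the tree's `Lemma32Flat.norm_hnum_le_sphere` with `2022 ↦ k + 7`: `ζ₁(1+z)⁴ ≤ (13/4)^{16}`, `|Γ(z+1)| ≤ 2C_Γ`,
`|ε(z)| ≤ 2(log A + log B)`, `|L(1+z,χ)| ≤ (1+4e^{9/2})𝓛^{−(k+7)}`, `|φ♭| ≤ e^{35ΣP}`).
[cite: Zhang2022LandauSiegel, §3, proof of Lemma 3.1 ("the residue at s = 1 is ≪ 𝓛^{-2011}"), four-factor variant] -/
theorem norm_hnum_le_sphere_scale (k : ℕ) (hχ : χ ^ 2 = 1) (hprim : χ.IsPrimitive) (hL : 3 ≤ Real.log D)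
    (hLA : ‖χ.LFunction 1‖ ≤ 1 / Real.log D ^ (k + 7)) (hA1 : 1 ≤ A) (hB1 : 1 ≤ B)
    (hAL : Real.log A ≤ 8 * Real.log D) (hBL : Real.log B ≤ 8 * Real.log D) {z : ℂ}
    (hz : ‖z‖ = 1 / Real.log D ^ (k + 9)) :
    ‖hnum χ A B z‖ ≤ Kres * (2 * (Real.log A + Real.log B)) / (Real.log D ^ (k + 7)) ^ 4 := by
  set Lg : ℝ := Real.log D with hLdef
  have hL1 : 1 ≤ Lg := by linarith
  have hL0 : 0 < Lg := by linarith
  have hD0 : D ≠ 0 := by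
    rintro rfl; simp [hLdef] at hL; linarith
  have hDpos : (0 : ℝ) < D := by exact_mod_cast Nat.pos_of_ne_zero hD0
  have hlA : 0 ≤ Real.log A := Real.log_nonneg hA1
  have hlB : 0 ≤ Real.log B := Real.log_nonneg hB1
  -- sizes of `r = 𝓛^{-(k+9)}`
  have hL2 : (9 : ℝ) ≤ Lg ^ (k + 9) := by
    calc (9 : ℝ) = 3 ^ 2 := by norm_num
      _ ≤ Lg ^ 2 := pow_le_pow_left₀ (by norm_num) hL 2
      _ ≤ Lg ^ (k + 9) := pow_le_pow_right₀ hL1 (by omega)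
  have hr9 : ‖z‖ ≤ 1 / 9 := by
    rw [hz]; exact div_le_div_of_nonneg_left (by norm_num) (by norm_num) hL2
  have hrL : ‖z‖ * Lg ≤ 1 / Lg ^ (k + 8) := by
    rw [hz]
    have : Lg ^ (k + 9) = Lg ^ (k + 8) * Lg := by rw [pow_succ]
    rw [this]; field_simp; exact le_rfl
  have hL2023 : (9 : ℝ) ≤ Lg ^ (k + 8) := by
    calc (9 : ℝ) = 3 ^ 2 := by norm_num
      _ ≤ Lg ^ 2 := pow_le_pow_left₀ (by norm_num) hL 2
      _ ≤ Lg ^ (k + 8) := pow_le_pow_right₀ hL1 (by omega)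
  have hrL1 : ‖z‖ * Lg ≤ 1 := hrL.trans (by rw [div_le_one (by positivity)]; linarith)
  have hrL8 : ‖z‖ * (8 * Lg) ≤ 1 := by
    have : ‖z‖ * (8 * Lg) = 8 * (‖z‖ * Lg) := by ring
    rw [this]
    calc 8 * (‖z‖ * Lg) ≤ 8 * (1 / Lg ^ (k + 8)) := by gcongr
      _ ≤ 1 := by rw [mul_one_div, div_le_one (by positivity)]; linarith
  have hz0 : z ≠ 0 := by
    intro h; rw [h, norm_zero] at hz
    have : (0 : ℝ) < 1 / Lg ^ (k + 9) := by positivity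
    linarith
  have hz1L : ‖z‖ ≤ 1 / Real.log D := by
    rw [← hLdef]
    calc ‖z‖ = ‖z‖ * Lg / Lg := by field_simp
      _ ≤ 1 / Lg := by gcongr
  have hzre : |z.re| ≤ 1 / 9 := (Complex.abs_re_le_norm z).trans hr9
  have hzim : |z.im| ≤ ‖z‖ := Complex.abs_im_le_norm z
  -- ζ₁(1+z)⁴
  have h1z : ‖(1 : ℂ) + z‖ ≤ 5 / 4 := by
    have := norm_add_le (1 : ℂ) z; rw [norm_one] at this; linarith
  have hζ₁ : ‖riemannZeta₁ (1 + z)‖ ≤ (13 / 4 : ℝ) ^ 4 := by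
    have h := BurnolVectors.norm_riemannZeta₁_le (s := 1 + z)
      (by rw [add_re, one_re]; have := neg_abs_le z.re; linarith)
    refine h.trans ?_
    have : ‖(1 : ℂ) + z‖ + 2 ≤ 13 / 4 := by linarith
    exact pow_le_pow_left₀ (by positivity) this 4
  have hζ4 : ‖riemannZeta₁ (1 + z)‖ ^ 4 ≤ (13 / 4 : ℝ) ^ 16 := by
    calc ‖riemannZeta₁ (1 + z)‖ ^ 4 ≤ ((13 / 4 : ℝ) ^ 4) ^ 4 := pow_le_pow_left₀ (norm_nonneg _) hζ₁ 4
      _ = (13 / 4 : ℝ) ^ 16 := by norm_num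
  -- Γ(z+1)
  have hC := CΓ_pos
  have hΓ : ‖Complex.Gamma (z + 1)‖ ≤ 2 * CΓ := by
    have := norm_Gamma_strip_le (x := z.re + 1) (by have := neg_abs_le z.re; linarith)
      (by have := le_abs_self z.re; linarith) z.im
    have e : ((z.re + 1 : ℝ) : ℂ) + z.im * I = z + 1 := by
      rw [show ((z.re + 1 : ℝ) : ℂ) = (z.re : ℂ) + 1 by push_cast; ring]
      conv_rhs => rw [← Complex.re_add_im z]
      ring
    rw [e] at this
    refine this.trans ?_
    have hy : |z.im| ≤ 1 / 9 := hzim.trans hr9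
    have hE : Real.exp (-(π * |z.im| / 2)) ≤ 1 := by
      rw [Real.exp_le_one_iff]
      have := Real.pi_pos; have := abs_nonneg z.im
      nlinarith
    calc CΓ * (1 + |z.im|) ^ 3 * Real.exp (-(π * |z.im| / 2))
        ≤ CΓ * (1 + 1 / 9) ^ 3 * 1 := by gcongr
      _ ≤ 2 * CΓ := by nlinarith
  -- ε(z)
  have hε : ‖eps A B z‖ ≤ 2 * (Real.log A + Real.log B) :=
    norm_eps_le_small hA1 hB1 hz0
      ((mul_le_mul_of_nonneg_left hAL (norm_nonneg _)).trans hrL8)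
      ((mul_le_mul_of_nonneg_left hBL (norm_nonneg _)).trans hrL8)
  -- L(1+z, χ)⁴ under the premise
  have hLz : ‖χ.LFunction (1 + z)‖ ≤ (1 + 4 * Real.exp (9 / 2)) / Lg ^ (k + 7) := by
    have hsub := norm_LFunction_one_add_sub_le χ hL hprim hz1L
    rw [← hLdef] at hsub
    have htri := norm_add_le (χ.LFunction (1 + z) - χ.LFunction 1) (χ.LFunction 1)
    rw [sub_add_cancel] at htri
    have hE := Real.exp_pos (9 / 2)
    have h2 : 2 * Real.exp (9 / 2) * (1 + Lg) * Lg * ‖z‖ ≤ 4 * Real.exp (9 / 2) / Lg ^ (k + 7) := by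
      have h1L : 1 + Lg ≤ 2 * Lg := by linarith
      calc 2 * Real.exp (9 / 2) * (1 + Lg) * Lg * ‖z‖
          ≤ 2 * Real.exp (9 / 2) * (2 * Lg) * Lg * ‖z‖ := by gcongr
        _ = 4 * Real.exp (9 / 2) * Lg * (‖z‖ * Lg) := by ring
        _ ≤ 4 * Real.exp (9 / 2) * Lg * (1 / Lg ^ (k + 8)) := by gcongr
        _ = 4 * Real.exp (9 / 2) / Lg ^ (k + 7) := by
            have : Lg ^ (k + 8) = Lg * Lg ^ (k + 7) := by rw [pow_succ']
            rw [this]; field_simp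
    calc ‖χ.LFunction (1 + z)‖ ≤ ‖χ.LFunction (1 + z) - χ.LFunction 1‖ + ‖χ.LFunction 1‖ := htri
      _ ≤ 2 * Real.exp (9 / 2) * (1 + Lg) * Lg * ‖z‖ + 1 / Lg ^ (k + 7) := add_le_add hsub hLA
      _ ≤ 4 * Real.exp (9 / 2) / Lg ^ (k + 7) + 1 / Lg ^ (k + 7) := by linarith
      _ = (1 + 4 * Real.exp (9 / 2)) / Lg ^ (k + 7) := by ring
  have hL4 : ‖χ.LFunction (1 + z)‖ ^ 4 ≤ (1 + 4 * Real.exp (9 / 2)) ^ 4 / (Lg ^ (k + 7)) ^ 4 := by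
    rw [← div_pow]; exact pow_le_pow_left₀ (norm_nonneg _) hLz 4
  -- φ♭(1+z): absolute bound near the real axis
  have hφ : ‖phiFlat χ (1 + z)‖ ≤ Real.exp (35 * Psum) := by
    refine norm_phiFlat_le_of_re_cpow_nonneg χ hχ (σ₀ := 3 / 4) (by norm_num) (s := 1 + z)
      (by rw [add_re, one_re]; have := neg_abs_le z.re; linarith) fun p hp hpD => ?_
    refine re_natCast_cpow_neg_nonneg hp.pos ?_
    have hpD' : (p : ℝ) ≤ D := by exact_mod_cast Nat.le_of_dvd (Nat.pos_of_ne_zero hD0) hpD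
    have hlogp : Real.log p ≤ Lg := Real.log_le_log (by exact_mod_cast hp.pos) hpD'
    have hlogp0 : 0 ≤ Real.log p := Real.log_nonneg (by exact_mod_cast hp.one_lt.le)
    have him : |(1 + z : ℂ).im| = |z.im| := by simp
    rw [him]
    calc |z.im| * Real.log p ≤ ‖z‖ * Lg := mul_le_mul hzim hlogp hlogp0 (norm_nonneg _)
      _ ≤ 1 := hrL1
      _ ≤ π / 2 := by linarith [Real.pi_gt_three]
  have hg : ‖gF χ z‖ ≤ (1 + 4 * Real.exp (9 / 2)) ^ 4 / (Lg ^ (k + 7)) ^ 4 * Real.exp (35 * Psum) := by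
    rw [gF, norm_mul, norm_pow]
    exact mul_le_mul hL4 hφ (norm_nonneg _) (by positivity)
  -- combine
  have s1 : ‖riemannZeta₁ (1 + z)‖ ^ 4 * ‖Complex.Gamma (z + 1)‖ ≤ (13 / 4 : ℝ) ^ 16 * (2 * CΓ) :=
    mul_le_mul hζ4 hΓ (norm_nonneg _) (by positivity)
  have s2 : ‖riemannZeta₁ (1 + z)‖ ^ 4 * ‖Complex.Gamma (z + 1)‖ * ‖eps A B z‖ ≤
      (13 / 4 : ℝ) ^ 16 * (2 * CΓ) * (2 * (Real.log A + Real.log B)) :=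
    mul_le_mul s1 hε (norm_nonneg _) (by positivity)
  have s3 : ‖riemannZeta₁ (1 + z)‖ ^ 4 * ‖Complex.Gamma (z + 1)‖ * ‖eps A B z‖ * ‖gF χ z‖ ≤
      (13 / 4 : ℝ) ^ 16 * (2 * CΓ) * (2 * (Real.log A + Real.log B)) *
        ((1 + 4 * Real.exp (9 / 2)) ^ 4 / (Lg ^ (k + 7)) ^ 4 * Real.exp (35 * Psum)) :=
    mul_le_mul s2 hg (norm_nonneg _) (by positivity)
  rw [hnum, norm_mul, norm_mul, norm_mul, norm_pow]
  refine s3.trans (le_of_eq ?_)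
  rw [Kres]; field_simp

/-- **Cauchy's estimate for the residue with the exponent free**: under the hypotheses of
`norm_hnum_le_sphere_scale` (and `χ ≠ 1`, `A, B > 0`),
`‖h‴(0)‖ ≤ 3!·K_res·2(log A + log B)·𝓛^{−4(k+7)} / 𝓛^{−3(k+9)}` (Mathlib's
`Complex.norm_iteratedDeriv_le_of_forall_mem_sphere_norm_le` on `|z| = 𝓛^{−(k+9)}`).
[cite: Zhang2022LandauSiegel, §3, proof of Lemma 3.1 (residue on the circle of radius 𝓛^{-2024}), four-factor variant] -/
theorem norm_iteratedDeriv_hnum_le_scale (k : ℕ) (hχ : χ ^ 2 = 1) (hprim : χ.IsPrimitive)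
    (hL : 3 ≤ Real.log D) (hLA : ‖χ.LFunction 1‖ ≤ 1 / Real.log D ^ (k + 7)) (hA1 : 1 ≤ A) (hB1 : 1 ≤ B)
    (hAL : Real.log A ≤ 8 * Real.log D) (hBL : Real.log B ≤ 8 * Real.log D) :
    ‖iteratedDeriv 3 (hnum χ A B) 0‖ ≤
      (Nat.factorial 3 : ℝ) * (Kres * (2 * (Real.log A + Real.log B)) / (Real.log D ^ (k + 7)) ^ 4) /
        (1 / Real.log D ^ (k + 9)) ^ 3 := by
  have hL1 : 1 ≤ Real.log D := by linarith
  have hq2 : 2 ≤ D := by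
    rcases Nat.lt_or_ge D 2 with h | h
    · interval_cases D <;> norm_num at hL
    · exact h
  have hχ1 := ne_one_of_isPrimitive χ hq2 hprim
  set r : ℝ := 1 / Real.log D ^ (k + 9) with hr
  have hr0 : 0 < r := by positivity
  have hd : DiffContOnCl ℂ (hnum χ A B) (ball 0 r) := by
    refine (differentiableOn_hnum χ hχ hχ1 (by linarith) (by linarith)).diffContOnCl_ball
      fun z hz => ?_
    rw [mem_closedBall, dist_zero_right] at hz
    simp only [mem_setOf_eq]
    have hL2 : (9 : ℝ) ≤ Real.log D ^ (k + 9) := by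
      calc (9 : ℝ) = 3 ^ 2 := by norm_num
        _ ≤ Real.log D ^ 2 := pow_le_pow_left₀ (by norm_num) hL 2
        _ ≤ Real.log D ^ (k + 9) := pow_le_pow_right₀ hL1 (by omega)
    have hr9 : r ≤ 1 / 9 := div_le_div_of_nonneg_left (by norm_num) (by norm_num) hL2
    have := Complex.abs_re_le_norm z
    have := neg_abs_le z.re
    linarith
  have hM : ∀ z ∈ sphere (0 : ℂ) r,
      ‖hnum χ A B z‖ ≤ Kres * (2 * (Real.log A + Real.log B)) / (Real.log D ^ (k + 7)) ^ 4 := by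
    intro z hz
    rw [mem_sphere, dist_zero_right] at hz
    exact norm_hnum_le_sphere_scale χ k hχ hprim hL hLA hA1 hB1 hAL hBL hz
  exact Complex.norm_iteratedDeriv_le_of_forall_mem_sphere_norm_le 3 hr0 hd hM

/-! ## Elementary bookkeeping with the exponent free -/

omit [NeZero D] in
/-- `(1+𝓛)⁵ / D^{1/4} ≤ 32 · (4(m+5))^{m+5} · 𝓛^{−m}` for `𝓛 = log D ≥ 1` and every natural `m`
(`𝓛 ≤ c·D^{1/c}`, `c = 4(m+5)`; the tree's `Lemma32Flat.aux_logpow5` is `m = 2015`).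
[cite: Zhang2022LandauSiegel, §3, proof of Lemma 3.1 (the D^{-1/2}(1+𝓛)³ = O(𝓛^{-2011}) step), four-factor variant] -/
theorem aux_logpow5_scale (m : ℕ) (hL : 1 ≤ Real.log D) (hD0 : (0 : ℝ) < D) :
    (1 + Real.log D) ^ 5 / (D : ℝ) ^ (1 / 4 : ℝ) ≤
      32 * (4 * ((m : ℝ) + 5)) ^ (m + 5) / Real.log D ^ m := by
  set Lg : ℝ := Real.log D with hLdef
  set c : ℝ := 4 * ((m : ℝ) + 5) with hcdef
  have hc0 : 0 < c := by rw [hcdef]; positivity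
  have hL0 : 0 < Lg := by linarith
  have h1 : Lg ≤ (D : ℝ) ^ (1 / c) / (1 / c) := Real.log_le_rpow_div hD0.le (by positivity)
  have h2 : Lg / c ≤ (D : ℝ) ^ (1 / c) := by
    rw [div_le_iff₀ hc0]
    have : (D : ℝ) ^ (1 / c) / (1 / c) = (D : ℝ) ^ (1 / c) * c := by
      rw [div_div_eq_mul_div, div_one]
    linarith
  have h3 : (Lg / c) ^ (m + 5) ≤ (D : ℝ) ^ (1 / 4 : ℝ) := by
    calc (Lg / c) ^ (m + 5) ≤ ((D : ℝ) ^ (1 / c)) ^ (m + 5) := pow_le_pow_left₀ (by positivity) h2 _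
      _ = (D : ℝ) ^ (1 / 4 : ℝ) := by
          rw [← Real.rpow_natCast, ← Real.rpow_mul hD0.le]
          congr 1
          rw [hcdef]; push_cast; field_simp
  have h4 : (1 + Lg) ^ 5 ≤ 32 * Lg ^ 5 := by
    have : 1 + Lg ≤ 2 * Lg := by linarith
    calc (1 + Lg) ^ 5 ≤ (2 * Lg) ^ 5 := pow_le_pow_left₀ (by linarith) this 5
      _ = 32 * Lg ^ 5 := by ring
  have h5 : 0 < (Lg / c) ^ (m + 5) := by positivity
  calc (1 + Lg) ^ 5 / (D : ℝ) ^ (1 / 4 : ℝ) ≤ 32 * Lg ^ 5 / (Lg / c) ^ (m + 5) := by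
        gcongr
    _ = 32 * c ^ (m + 5) / Lg ^ m := by
        have hLm5 : Lg ^ (m + 5) = Lg ^ m * Lg ^ 5 := by rw [← pow_add]
        rw [div_pow, hLm5]
        field_simp

/-! ## The scale law: saving `𝓛^{−k}` over `D⁴ < n ≤ D⁸` from `‖L(1,χ)‖ ≤ 𝓛^{−(k+7)}` -/

/-- **Lemma 3.2♭ with the exponent free (sufficiency).** For every natural `k` there is `C = C(k)` such
that for every `D` with `log D ≥ 3`, every PRIMITIVE Dirichlet character `χ` mod `D` with `χ² = 1` and
`‖L(1,χ)‖ ≤ (log D)^{−(k+7)}`, and every `N ≤ D⁸`,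
`∑_{D⁴<n≤N} |ν(n)|² d(n)/n ≤ C (log D)^{−k}` (`ν = 1 ∗ χ`, `d` = number of divisors). The tree's proof of
`Lemma32Flat.lemma_3_2_flat` verbatim with `2022 ↦ k + 7`, Cauchy radius `𝓛^{−2024} ↦ 𝓛^{−(k+9)}`,
`D^{−1/4}(1+𝓛)⁵ ↦ aux_logpow5_scale k`; residue `144K_res𝓛^{−k}` (`4(k+7) = k + 1 + 3(k+9)`); the
printed-shape lemma is `k = 2015`. [cite: Zhang2022LandauSiegel, §3, Lemma 3.2 (variant: ν²τ₂ in place of ν²τ₂², cf. ALT-1 §4)] -/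
theorem lemma32Flat_scale_of_norm_le (k : ℕ) :
    ∃ C : ℝ, ∀ (D : ℕ) [NeZero D] (χ : DirichletCharacter ℂ D),
    χ.IsPrimitive → χ ^ 2 = 1 → 3 ≤ Real.log D →
    ‖χ.LFunction 1‖ ≤ 1 / Real.log D ^ (k + 7) →
    ∀ N : ℕ, (N : ℝ) ≤ (D : ℝ) ^ 8 →
      ∑ n ∈ Finset.Ioc (D ^ 4) N, ‖divisorSumChar χ n‖ ^ 2 * (n.divisors.card : ℝ) / n ≤
        C / Real.log D ^ k := by
  obtain ⟨Cd, hCd1, hCd⟩ := Sieve.exists_card_divisors_le_mul_rpow (by norm_num : (0 : ℝ) < 1 / 8)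
  refine ⟨6 * (24 * Kres + 2 * 48 ^ 23 * KlineFlat * Cd ^ 2 * (2 * (32 * (4 * ((k : ℝ) + 5)) ^ (k + 5)))), ?_⟩
  intro D _ χ hprim hχ2 hL hA N hN
  set M : ℝ := (4 * ((k : ℝ) + 5)) ^ (k + 5) with hM
  set M' : ℝ := (48 : ℝ) ^ 23 with hM'
  clear_value M'
  set Lg : ℝ := Real.log D with hLdef
  have hL1 : 1 ≤ Lg := by linarith
  have hL0 : 0 < Lg := by linarith
  have hD0 : D ≠ 0 := by
    rintro rfl; simp [hLdef] at hL; linarith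
  have hDpos : (0 : ℝ) < D := by exact_mod_cast Nat.pos_of_ne_zero hD0
  have hD8 : 8 ≤ D := by
    have h1 : Real.exp 3 ≤ Real.exp Lg := Real.exp_le_exp.2 hL
    rw [hLdef, Real.exp_log hDpos] at h1
    have := eight_lt_exp_three
    exact_mod_cast (show (8 : ℝ) ≤ D by linarith)
  have hχ1 := ne_one_of_isPrimitive χ (by omega) hprim
  obtain ⟨hApos, h4AB, hABsum, hA1, hB1, hlogA, hlogB⟩ := Lemma32Flat.aux_AB (D := D) hL
  set A : ℝ := (D : ℝ) ^ 4 with hAdef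
  set B : ℝ := (D : ℝ) ^ 8 with hBdef
  have hBpos : 0 < B := by linarith
  -- (1) smoothing
  have hS := Lemma32Flat.sum_Ioc_le χ hχ2 hApos h4AB (M := D ^ 4) (N := N)
    (by rw [hAdef]; push_cast; exact le_rfl) hN
  -- (2) the contour shift across the pole of order four at `z = 0`
  set U : Set ℂ := {z : ℂ | -(1 / 2) < z.re} with hU
  have hUo : IsOpen U := isOpen_lt continuous_const Complex.continuous_re
  have hstrip := Literature.Analysis.Complex.integral_vertical_sub_eq_sum_of_poles
    (F := Fint χ A B) (σ₁ := -(1 / 4)) (κ := 2) (by norm_num) ({0} : Finset ℂ) (fun _ => 3)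
    (fun _ => hnum χ A B) U hUo
    (fun z hz => by
      simp only [mem_preimage, mem_Icc] at hz
      show -(1 / 2) < z.re
      linarith [hz.1])
    (fun p hp => by rw [Finset.mem_singleton] at hp; rw [hp]; simp)
    (by rw [Finset.coe_singleton]; exact differentiableOn_Fint χ hχ2 hχ1 hApos hBpos)
    (fun p hp => by
      rw [Finset.mem_singleton] at hp
      subst hp
      refine ⟨U, hUo.mem_nhds (by simp [hU]), differentiableOn_hnum χ hχ2 hχ1 hApos hBpos,
        fun z hz hz0 => ?_⟩
      refine Fint_eq_hnum_div χ hz0 fun m hm => ?_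
      have hzre : -(1 / 2) < z.re := hz
      rw [hm] at hzre hz0
      simp at hzre
      have : m = 0 := by
        by_contra h
        have : (1 : ℝ) ≤ m := by exact_mod_cast Nat.one_le_iff_ne_zero.2 h
        linarith
      subst this
      simp at hz0)
    (integrable_Fint_line χ hχ2 hχ1 hApos hBpos (Or.inr rfl))
    (integrable_Fint_line χ hχ2 hχ1 hApos hBpos (Or.inl rfl))
    (Fint_horizontal_decay χ hχ2 hχ1 hApos hBpos)
  rw [Finset.sum_singleton] at hstrip
  -- the line `re z = 2`
  have h2 := (integral_Fint_line_two χ hχ2 hApos hBpos).2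
  have e2 : (∫ t : ℝ, Fint χ A B (((2 : ℝ) : ℂ) + t * I)) = ∫ t : ℝ, Fint χ A B (2 + t * I) := by
    norm_num
  rw [e2, h2] at hstrip
  -- so `2π (W(B) − W(A)) = 2π · h‴(0)/3! + ∫_{re z = −1/4} F`
  have hX : 2 * (π : ℂ) * (W (coeff χ) B - W (coeff χ) A) =
      2 * π * (iteratedDeriv 3 (hnum χ A B) 0 / ((Nat.factorial 3 : ℕ) : ℂ)) +
        ∫ t : ℝ, Fint χ A B ((((-(1 / 4) : ℝ)) : ℂ) + t * I) := sub_eq_iff_eq_add.1 hstrip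
  have h2π : ‖(2 * (π : ℂ))‖ = 2 * π := by
    rw [norm_mul, Complex.norm_ofNat, Complex.norm_real, Real.norm_eq_abs, abs_of_pos Real.pi_pos]
  have hnormX : 2 * π * ‖W (coeff χ) B - W (coeff χ) A‖ ≤
      2 * π * ‖iteratedDeriv 3 (hnum χ A B) 0 / ((Nat.factorial 3 : ℕ) : ℂ)‖ +
        ‖∫ t : ℝ, Fint χ A B ((((-(1 / 4) : ℝ)) : ℂ) + t * I)‖ := by
    have h := congrArg (fun w : ℂ => ‖w‖) hX
    simp only [norm_mul, h2π] at h
    rw [h]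
    refine (norm_add_le _ _).trans (le_of_eq ?_)
    rw [norm_mul, h2π]
  have hΔn0 : ‖W (coeff χ) B - W (coeff χ) A‖ ≤
      ‖iteratedDeriv 3 (hnum χ A B) 0 / ((Nat.factorial 3 : ℕ) : ℂ)‖ +
        ‖∫ t : ℝ, Fint χ A B ((((-(1 / 4) : ℝ)) : ℂ) + t * I)‖ := by
    have hπ3 := Real.pi_gt_three
    have hI0 := norm_nonneg (∫ t : ℝ, Fint χ A B ((((-(1 / 4) : ℝ)) : ℂ) + t * I))
    have h1 : ‖∫ t : ℝ, Fint χ A B ((((-(1 / 4) : ℝ)) : ℂ) + t * I)‖ ≤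
        2 * π * ‖∫ t : ℝ, Fint χ A B ((((-(1 / 4) : ℝ)) : ℂ) + t * I)‖ := by nlinarith
    have h2 : 2 * π * ‖W (coeff χ) B - W (coeff χ) A‖ ≤
        2 * π * (‖iteratedDeriv 3 (hnum χ A B) 0 / ((Nat.factorial 3 : ℕ) : ℂ)‖ +
          ‖∫ t : ℝ, Fint χ A B ((((-(1 / 4) : ℝ)) : ℂ) + t * I)‖) := by linarith
    exact le_of_mul_le_mul_left h2 (by positivity)
  -- (3) the residue term
  have hres := norm_iteratedDeriv_hnum_le_scale χ k hχ2 hprim hL hA hA1 hB1 hlogA hlogB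
  have hfac : ((Nat.factorial 3 : ℕ) : ℝ) = 6 := by norm_num [Nat.factorial]
  have hT1 : ‖iteratedDeriv 3 (hnum χ A B) 0 / ((Nat.factorial 3 : ℕ) : ℂ)‖ ≤ 24 * Kres / Lg ^ k := by
    rw [norm_div, Complex.norm_natCast, hfac]
    rw [hfac, ← hLdef] at hres
    have hK := Kres_nonneg
    have hsum : Real.log A + Real.log B ≤ 12 * Lg := by
      rw [hAdef, hBdef, Real.log_pow, Real.log_pow, ← hLdef]; push_cast; linarith
    have step : 6 * (Kres * (2 * (Real.log A + Real.log B)) / (Lg ^ (k + 7)) ^ 4) /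
        (1 / Lg ^ (k + 9)) ^ 3 ≤
        6 * (Kres * (2 * (12 * Lg)) / (Lg ^ (k + 7)) ^ 4) / (1 / Lg ^ (k + 9)) ^ 3 := by
      gcongr
    have e : 6 * (Kres * (2 * (12 * Lg)) / (Lg ^ (k + 7)) ^ 4) / (1 / Lg ^ (k + 9)) ^ 3 =
        6 * (24 * Kres / Lg ^ k) := by
      have h8088 : (Lg ^ (k + 7)) ^ 4 = Lg ^ k * Lg * (Lg ^ (k + 9)) ^ 3 := by ring
      rw [h8088]
      field_simp
      ring
    rw [div_le_iff₀ (by norm_num : (0 : ℝ) < 6)]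
    calc ‖iteratedDeriv 3 (hnum χ A B) 0‖
        ≤ 6 * (Kres * (2 * (Real.log A + Real.log B)) / (Lg ^ (k + 7)) ^ 4) /
            (1 / Lg ^ (k + 9)) ^ 3 := hres
      _ ≤ 6 * (24 * Kres / Lg ^ k) := step.trans (le_of_eq e)
      _ = 24 * Kres / Lg ^ k * 6 := by ring
  -- (4) the shifted integral (no (A))
  have hT2 : ‖∫ t : ℝ, Fint χ A B ((((-(1 / 4) : ℝ)) : ℂ) + t * I)‖ ≤
      2 * M' * KlineFlat * Cd ^ 2 * (2 * (32 * M)) / Lg ^ k := by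
    have hI := norm_integral_Fint_line_le χ hχ2 hprim hD8 hApos hBpos
    rw [← hM'] at hI
    set t : ℝ := (D : ℝ) ^ (1 / 8 : ℝ) with htdef
    have ht0 : 0 < t := by positivity
    have ht2 : (D : ℝ) ^ (1 / 4 : ℝ) = t ^ 2 := by
      rw [htdef, ← Real.rpow_natCast, ← Real.rpow_mul hDpos.le]; norm_num
    have ht4 : Real.sqrt D = t ^ 4 := by
      rw [Real.sqrt_eq_rpow, htdef, ← Real.rpow_natCast, ← Real.rpow_mul hDpos.le]; norm_num
    have ht8 : (D : ℝ) = t ^ 8 := by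
      rw [htdef, ← Real.rpow_natCast, ← Real.rpow_mul hDpos.le]; norm_num
    have hτ : (D.divisors.card : ℝ) ≤ Cd * t := hCd D hD0
    have hτ2 : (D.divisors.card : ℝ) ^ 2 ≤ (Cd * t) ^ 2 := pow_le_pow_left₀ (Nat.cast_nonneg _) hτ 2
    have hlp := aux_logpow5_scale k (D := D) hL1 hDpos
    rw [ht2, ← hLdef, ← hM] at hlp
    have hK := KlineFlat_pos
    have hM'0 : 0 ≤ M' := by rw [hM']; positivity
    have hmain : KlineFlat * (D.divisors.card : ℝ) ^ 2 * Real.sqrt D * (1 + Lg) ^ 5 *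
        (A ^ (-(1 / 4) : ℝ) + B ^ (-(1 / 4) : ℝ)) ≤ KlineFlat * Cd ^ 2 * (2 * (32 * M / Lg ^ k)) := by
      calc KlineFlat * (D.divisors.card : ℝ) ^ 2 * Real.sqrt D * (1 + Lg) ^ 5 *
            (A ^ (-(1 / 4) : ℝ) + B ^ (-(1 / 4) : ℝ))
          ≤ KlineFlat * (Cd * t) ^ 2 * t ^ 4 * (1 + Lg) ^ 5 * (2 / D) := by
            rw [ht4]; gcongr
        _ = KlineFlat * Cd ^ 2 * (2 * ((1 + Lg) ^ 5 / t ^ 2)) := by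
            rw [ht8]; field_simp
        _ ≤ KlineFlat * Cd ^ 2 * (2 * (32 * M / Lg ^ k)) := by gcongr
    calc ‖∫ t : ℝ, Fint χ A B ((((-(1 / 4) : ℝ)) : ℂ) + t * I)‖
        ≤ 2 * M' * (KlineFlat * (D.divisors.card : ℝ) ^ 2 * Real.sqrt D * (1 + Real.log D) ^ 5 *
            (A ^ (-(1 / 4) : ℝ) + B ^ (-(1 / 4) : ℝ))) := hI
      _ ≤ 2 * M' * (KlineFlat * Cd ^ 2 * (2 * (32 * M / Lg ^ k))) := by
          rw [← hLdef]; gcongr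
      _ = 2 * M' * KlineFlat * Cd ^ 2 * (2 * (32 * M)) / Lg ^ k := by ring
  -- (5) combine
  have hΔn : ‖W (coeff χ) B - W (coeff χ) A‖ ≤
      (24 * Kres + 2 * M' * KlineFlat * Cd ^ 2 * (2 * (32 * M))) / Lg ^ k := by
    refine hΔn0.trans ?_
    rw [add_div]
    exact add_le_add hT1 hT2
  calc ∑ n ∈ Finset.Ioc (D ^ 4) N, ‖divisorSumChar χ n‖ ^ 2 * (n.divisors.card : ℝ) / n
      ≤ 6 * (W (coeff χ) B - W (coeff χ) A).re := hS
    _ ≤ 6 * ‖W (coeff χ) B - W (coeff χ) A‖ := by gcongr; exact Complex.re_le_norm _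
    _ ≤ 6 * ((24 * Kres + 2 * M' * KlineFlat * Cd ^ 2 * (2 * (32 * M))) / Lg ^ k) := by gcongr
    _ = _ := by rw [hLdef, hM']; ring

/-- **Lemma 3.2♭ with the exponent free, from `AssumptionAWith E`** for every real `E ≥ k + 7`:
`∑_{D⁴<n≤N} |ν(n)|²d(n)/n ≤ C𝓛^{−k}` for `N ≤ D⁸`, `log D ≥ 3`, `χ` primitive with `χ² = 1`.
[cite: Zhang2022LandauSiegel, §3, Lemma 3.2 (variant: ν²τ₂ in place of ν²τ₂², cf. ALT-1 §4)] -/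
theorem lemma32Flat_scale_of_assumptionAWith (k : ℕ) {E : ℝ} (hE : ((k + 7 : ℕ) : ℝ) ≤ E) :
    ∃ C : ℝ, ∀ (D : ℕ) [NeZero D] (χ : DirichletCharacter ℂ D),
    χ.IsPrimitive → χ ^ 2 = 1 → 3 ≤ Real.log D → AssumptionAWith E D χ →
    ∀ N : ℕ, (N : ℝ) ≤ (D : ℝ) ^ 8 →
      ∑ n ∈ Finset.Ioc (D ^ 4) N, ‖divisorSumChar χ n‖ ^ 2 * (n.divisors.card : ℝ) / n ≤
        C / Real.log D ^ k := by
  obtain ⟨C, hC⟩ := lemma32Flat_scale_of_norm_le k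
  exact ⟨C, fun D _ χ hprim hχ2 hL hA N hN =>
    hC D χ hprim hχ2 hL (norm_le_pow_of_assumptionAWith χ (by linarith) hE hA) N hN⟩

end Literature.NumberTheory.LFunctions.Zhang2022.Repair.Gap

end
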